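import Summits.AtomisticToContinuum.Crystallization.Theorems.PricedLinkCensusLocalToGlobalThomsonCutoff
import Summits.AtomisticToContinuum.Crystallization.Theorems.PricedLinkCensusLocalToGlobalThomsonDefs
import Literature.Analysis.Calculus.SmoothCutoff

/-!
# Smooth cut-offs at the walls of a polyhedral tube

Route `PricedLinkCensus`, crux `LocalToGlobal` (stmt-AtomisticToContinuum-14232), line
`flux-cell-joint-census`, support for the registered stub `stub_fccMirrorExact : NewtonShell8 → FccMirrorExact`
(`Theorems/PricedLinkCensusLocalToGlobalDefs`), second half (`fluxCell ≤ S₆`).  The admissibility of the field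
of the method of images requires passing from Gauss laws for tests supported INSIDE the open tube
`U = {z : ⟪z, Wₘ⟫ < αₘ, m ∈ M}` (a finite intersection of open half-spaces of `ℝ⁸`) to tests on all of `ℝ⁸`,
restricted to the tube.  The device is the product cut-off

  `polyCut W α n z = Π_{m ∈ M} θ(n (αₘ - ⟪z, Wₘ⟫) - 1)`,  `θ = Real.smoothTransition`,

(`wallCut` for one wall): smooth, `0 ≤ polyCut ≤ 1`, supported where all `αₘ - ⟪z, Wₘ⟫ ≥ 1/n` (inside `U`), equal to
`1` where all `αₘ - ⟪z, Wₘ⟫ ≥ 2/n` (so `→ 𝟙_U` pointwise), with the derivative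
`D(polyCut) = Σₘ (Π_{m' ≠ m} θ_{m'}) θ′ₘ · (-n) ⟪·, Wₘ⟫`.  The key estimate of the wall layers is the
integration by parts (`θ′ ≥ 0`)

  `∫ n θ′(n (α - ⟪z, W⟫) - 1) χ(z) dz ≤ ‖W‖⁻² ∫ |Dχ(z) W| dz`   (`integral_layer_mul_le`)

for nonnegative `χ ∈ C¹_c(ℝ⁸)`, uniformly in `n` (registered sub-goal `fccMirror_wallLayer_ibp`).

References: folklore (cut-off functions; L. C. Evans, *PDE* (2010), App. C.4); Mathlib `Real.smoothTransition`; tree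
`Literature.Analysis.Calculus.SmoothCutoff` (derivative of the transition function).
-/

noncomputable section

open MeasureTheory Set Filter Metric Topology InnerProductSpace Function
open scoped RealInnerProductSpace BigOperators

namespace Summit.AtomisticToContinuum.Crystallization.Theorems.PricedLinkCensusLocalToGlobal

/-! ### The transition function

`θ = Real.smoothTransition`; its derivative facts (`θ′ = 0` on `(-∞, 0]` and `[1, ∞)`, differentiability) are
the tree's `Literature.Analysis.Calculus.SmoothCutoff`. -/

/-! ### The cut-off at one wall -/

/-- THE CUT-OFF AT THE WALL `⟪z, W⟫ = α`: `θ(n(α - ⟪z, W⟫) - 1)` (`= 0` where `α - ⟪z, W⟫ ≤ 1/n`, `= 1` where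
`α - ⟪z, W⟫ ≥ 2/n`). [folklore] -/
def wallCut (W : E8) (α : ℝ) (n : ℕ) (z : E8) : ℝ := Real.smoothTransition ((n : ℝ) * (α - ⟪z, W⟫) - 1)

section OneWall

variable (W : E8) (α : ℝ) (n : ℕ)

/-- `0 ≤ wallCut ≤ 1`. [folklore] -/
theorem wallCut_mem_Icc (z : E8) : wallCut W α n z ∈ Icc (0 : ℝ) 1 :=
  ⟨Real.smoothTransition.nonneg _, Real.smoothTransition.le_one _⟩

/-- `wallCut = 0` where `α - ⟪z, W⟫ ≤ 1/n` (`n ≥ 1`). [folklore] -/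
theorem wallCut_eq_zero {z : E8} (hn : 1 ≤ n) (hz : α - ⟪z, W⟫ ≤ 1 / n) : wallCut W α n z = 0 := by
  refine Real.smoothTransition.zero_of_nonpos ?_
  have hn' : (0 : ℝ) < n := by exact_mod_cast hn
  have := (le_div_iff₀' hn').1 hz
  linarith

/-- `wallCut = 1` where `α - ⟪z, W⟫ ≥ 2/n` (`n ≥ 1`). [folklore] -/
theorem wallCut_eq_one {z : E8} (hn : 1 ≤ n) (hz : 2 / n ≤ α - ⟪z, W⟫) : wallCut W α n z = 1 := by
  refine Real.smoothTransition.one_of_one_le ?_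
  have hn' : (0 : ℝ) < n := by exact_mod_cast hn
  have := (div_le_iff₀' hn').1 hz
  linarith

/-- The affine argument `z ↦ n(α - ⟪z, W⟫) - 1` has derivative `-n ⟪·, W⟫`. [folklore] -/
theorem hasFDerivAt_wallArg (z : E8) :
    HasFDerivAt (fun z : E8 => (n : ℝ) * (α - ⟪z, W⟫) - 1) ((-(n : ℝ)) • (innerSL ℝ W : E8 →L[ℝ] ℝ)) z := by
  have h1 : HasFDerivAt (fun z : E8 => ⟪z, W⟫) (innerSL ℝ W : E8 →L[ℝ] ℝ) z := by
    have h := (innerSL ℝ W : E8 →L[ℝ] ℝ).hasFDerivAt (x := z)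
    refine h.congr_of_eventuallyEq (Eventually.of_forall fun y => ?_)
    simp only [innerSL_apply_apply]
    exact real_inner_comm _ _
  have h2 := ((h1.const_sub α).const_mul (n : ℝ)).sub_const 1
  refine h2.congr_fderiv ?_
  ext v
  simp

/-- **Derivative of the wall cut-off**: `D(wallCut)(z) = θ′(n(α - ⟪z,W⟫) - 1) · (-n) ⟪·, W⟫`. [folklore] -/
theorem hasFDerivAt_wallCut (z : E8) :
    HasFDerivAt (wallCut W α n)
      ((deriv Real.smoothTransition ((n : ℝ) * (α - ⟪z, W⟫) - 1) * (-(n : ℝ))) • (innerSL ℝ W : E8 →L[ℝ] ℝ)) z := by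
  have h := (Literature.Analysis.Calculus.differentiable_smoothTransition _).hasDerivAt.comp_hasFDerivAt z
    (hasFDerivAt_wallArg W α n z)
  rw [smul_smul] at h
  exact h

/-- `wallCut` is `C¹`. [folklore] -/
theorem contDiff_wallCut : ContDiff ℝ 1 (wallCut W α n) := by
  have h1 : ContDiff ℝ 1 fun z : E8 => ⟪z, W⟫ := contDiff_id.inner ℝ contDiff_const
  have h : ContDiff ℝ 1 fun z : E8 => (n : ℝ) * (α - ⟪z, W⟫) - 1 :=
    (contDiff_const.mul (contDiff_const.sub h1)).sub contDiff_const
  exact (Real.smoothTransition.contDiff (n := 1)).comp h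

/-- The directional derivative along `W`: `D(wallCut)(z) W = -n ‖W‖² θ′(…)`. [folklore] -/
theorem fderiv_wallCut_self (z : E8) :
    fderiv ℝ (wallCut W α n) z W = -((n : ℝ) * ‖W‖ ^ 2 * deriv Real.smoothTransition ((n : ℝ) * (α - ⟪z, W⟫) - 1)) := by
  rw [(hasFDerivAt_wallCut W α n z).fderiv, _root_.FunLike.coe_smul, Pi.smul_apply, innerSL_apply_apply,
    real_inner_self_eq_norm_sq, smul_eq_mul]
  ring

/-- **THE WALL-LAYER INTEGRATION BY PARTS**: for `χ ∈ C¹_c(ℝ⁸)` and `W ≠ 0`,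
`∫ n θ′(n(α - ⟪z, W⟫) - 1) χ(z) dz ≤ ‖W‖⁻² ∫ |Dχ(z) W| dz`, uniformly in `n`
(`n ‖W‖² θ′ = -D(wallCut) W`, `∫ D(wallCut · χ) W = 0`, `0 ≤ wallCut ≤ 1`). [folklore] -/
theorem integral_layer_mul_le {W : E8} (hW : W ≠ 0) (α : ℝ) (n : ℕ) {χ : E8 → ℝ} (hχ : ContDiff ℝ 1 χ)
    (hχc : HasCompactSupport χ) :
    ∫ z, (n : ℝ) * deriv Real.smoothTransition ((n : ℝ) * (α - ⟪z, W⟫) - 1) * χ z ≤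
      (‖W‖ ^ 2)⁻¹ * ∫ z, |fderiv ℝ χ z W| := by
  have hW2 : 0 < ‖W‖ ^ 2 := pow_pos (norm_pos_iff.2 hW) 2
  set H : E8 → ℝ := wallCut W α n with hH
  have hH1 : ContDiff ℝ 1 H := contDiff_wallCut W α n
  -- `∫ D(H χ) W = 0`
  have hprod : ContDiff ℝ 1 fun z => H z * χ z := hH1.mul hχ
  have hzero := Literature.Analysis.FluidPDE.integral_fderiv_apply_eq_zero hprod (hχc.mul_left) W
  have hsplit : ∀ z, fderiv ℝ (fun z => H z * χ z) z W = fderiv ℝ H z W * χ z + H z * fderiv ℝ χ z W := fun z => by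
    rw [fderiv_fun_mul (hH1.differentiable one_ne_zero z) (hχ.differentiable one_ne_zero z)]
    simp only [_root_.FunLike.coe_add, _root_.FunLike.coe_smul, Pi.add_apply, Pi.smul_apply, smul_eq_mul]
    ring
  -- integrability of the two pieces
  have hc1 : Continuous fun z => fderiv ℝ H z W := (hH1.continuous_fderiv one_ne_zero).clm_apply continuous_const
  have hc2 : Continuous fun z => fderiv ℝ χ z W := (hχ.continuous_fderiv one_ne_zero).clm_apply continuous_const
  have hi1 : Integrable fun z => fderiv ℝ H z W * χ z := (hc1.mul hχ.continuous).integrable_of_hasCompactSupport hχc.mul_left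
  have hi2 : Integrable fun z => H z * fderiv ℝ χ z W :=
    (hH1.continuous.mul hc2).integrable_of_hasCompactSupport ((hχc.fderiv_apply (𝕜 := ℝ) W).mul_left)
  have hsum : (∫ z, fderiv ℝ H z W * χ z) + ∫ z, H z * fderiv ℝ χ z W = 0 := by
    rw [← integral_add hi1 hi2, ← hzero]
    exact integral_congr_ae (Eventually.of_forall fun z => (hsplit z).symm)
  -- the left-hand side is `-‖W‖⁻² ∫ D(H) W χ`
  have hL : ∫ z, (n : ℝ) * deriv Real.smoothTransition ((n : ℝ) * (α - ⟪z, W⟫) - 1) * χ z =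
      -(‖W‖ ^ 2)⁻¹ * ∫ z, fderiv ℝ H z W * χ z := by
    rw [← integral_const_mul]
    refine integral_congr_ae (Eventually.of_forall fun z => ?_)
    simp only
    rw [hH, fderiv_wallCut_self]
    field_simp
  have hA : ∫ z, fderiv ℝ H z W * χ z = -∫ z, H z * fderiv ℝ χ z W := by linarith
  rw [hL, hA, mul_neg, neg_mul, neg_neg]
  have hi3 : Integrable (fun z => |fderiv ℝ χ z W|) (volume : Measure E8) := by
    have := (hc2.norm).integrable_of_hasCompactSupport (μ := (volume : Measure E8)) ((hχc.fderiv_apply (𝕜 := ℝ) W).norm)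
    simpa [Real.norm_eq_abs] using this
  refine mul_le_mul_of_nonneg_left (integral_mono hi2 hi3 fun z => ?_) (by positivity)
  have hH01 := wallCut_mem_Icc W α n z
  calc H z * fderiv ℝ χ z W ≤ |H z * fderiv ℝ χ z W| := le_abs_self _
    _ = |H z| * |fderiv ℝ χ z W| := abs_mul _ _
    _ ≤ 1 * |fderiv ℝ χ z W| := mul_le_mul_of_nonneg_right (by rw [abs_of_nonneg hH01.1]; exact hH01.2) (abs_nonneg _)
    _ = _ := one_mul _

/-- **Registered sub-goal `fccMirror_wallLayer_ibp`** (line `flux-cell-joint-census`, support of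
`stub_fccMirrorExact`): the wall-layer integration by parts, binder form of `integral_layer_mul_le`. [folklore] -/
theorem fccMirror_wallLayer_ibp : ∀ (W : E8), W ≠ 0 → ∀ (α : ℝ) (n : ℕ) (χ : E8 → ℝ), ContDiff ℝ 1 χ →
    HasCompactSupport χ →
    ∫ z, (n : ℝ) * deriv Real.smoothTransition ((n : ℝ) * (α - inner ℝ z W) - 1) * χ z ≤
      (‖W‖ ^ 2)⁻¹ * ∫ z, |fderiv ℝ χ z W| :=
  fun _ hW α n _ hχ hχc => integral_layer_mul_le hW α n hχ hχc

/-- `θ′(n(α - ⟪z, W⟫) - 1) ≠ 0` only in the layer `1/n ≤ α - ⟪z, W⟫ ≤ 2/n` (`n ≥ 1`). [folklore] -/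
theorem layer_of_deriv_ne_zero {z : E8} (hn : 1 ≤ n)
    (h : deriv Real.smoothTransition ((n : ℝ) * (α - ⟪z, W⟫) - 1) ≠ 0) :
    1 / (n : ℝ) ≤ α - ⟪z, W⟫ ∧ α - ⟪z, W⟫ ≤ 2 / n := by
  have hn' : (0 : ℝ) < n := by exact_mod_cast hn
  have h0 : 0 ≤ (n : ℝ) * (α - ⟪z, W⟫) - 1 := not_lt.1 fun hlt =>
    h (Literature.Analysis.Calculus.deriv_smoothTransition_of_nonpos hlt.le)
  have h1 : (n : ℝ) * (α - ⟪z, W⟫) - 1 ≤ 1 := not_lt.1 fun hlt =>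
    h (Literature.Analysis.Calculus.deriv_smoothTransition_of_one_le hlt.le)
  constructor
  · rw [div_le_iff₀' hn']; linarith
  · rw [le_div_iff₀' hn']; linarith

end OneWall

/-! ### The product cut-off of a polyhedral tube -/

/-- THE PRODUCT CUT-OFF of the tube `{z : ⟪z, Wₘ⟫ < αₘ, m ∈ M}`: `Π_{m ∈ M} wallCut (W m) (α m) n`. [folklore] -/
def polyCut {ι : Type*} (M : Finset ι) (W : ι → E8) (α : ι → ℝ) (n : ℕ) (z : E8) : ℝ :=
  ∏ m ∈ M, wallCut (W m) (α m) n z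

section Poly

variable {ι : Type*} (M : Finset ι) (W : ι → E8) (α : ι → ℝ) (n : ℕ)

/-- `0 ≤ polyCut ≤ 1`. [folklore] -/
theorem polyCut_mem_Icc (z : E8) : polyCut M W α n z ∈ Icc (0 : ℝ) 1 :=
  ⟨Finset.prod_nonneg fun _ _ => (wallCut_mem_Icc _ _ _ z).1,
    Finset.prod_le_one (fun _ _ => (wallCut_mem_Icc _ _ _ z).1) fun _ _ => (wallCut_mem_Icc _ _ _ z).2⟩

/-- Partial products are in `[0, 1]` too. [folklore] -/
theorem prod_erase_wallCut_mem_Icc [DecidableEq ι] (m : ι) (z : E8) :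
    ∏ m' ∈ M.erase m, wallCut (W m') (α m') n z ∈ Icc (0 : ℝ) 1 :=
  ⟨Finset.prod_nonneg fun _ _ => (wallCut_mem_Icc _ _ _ z).1,
    Finset.prod_le_one (fun _ _ => (wallCut_mem_Icc _ _ _ z).1) fun _ _ => (wallCut_mem_Icc _ _ _ z).2⟩

/-- `polyCut = 0` as soon as one gap is `≤ 1/n` (`n ≥ 1`). [folklore] -/
theorem polyCut_eq_zero (hn : 1 ≤ n) {z : E8} {m : ι} (hm : m ∈ M) (hz : α m - ⟪z, W m⟫ ≤ 1 / n) :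
    polyCut M W α n z = 0 :=
  Finset.prod_eq_zero hm (wallCut_eq_zero (W m) (α m) n hn hz)

/-- `polyCut = 1` where all gaps are `≥ 2/n` (`n ≥ 1`). [folklore] -/
theorem polyCut_eq_one (hn : 1 ≤ n) {z : E8} (hz : ∀ m ∈ M, 2 / (n : ℝ) ≤ α m - ⟪z, W m⟫) : polyCut M W α n z = 1 :=
  Finset.prod_eq_one fun m hm => wallCut_eq_one (W m) (α m) n hn (hz m hm)

/-- `polyCut = 0` off the tube (`n ≥ 1`). [folklore] -/
theorem polyCut_eq_zero_of_not_mem (hn : 1 ≤ n) {z : E8} (hz : ¬∀ m ∈ M, ⟪z, W m⟫ < α m) :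
    polyCut M W α n z = 0 := by
  push Not at hz
  obtain ⟨m, hm, hzm⟩ := hz
  have h0 : (0 : ℝ) ≤ 1 / n := by positivity
  exact polyCut_eq_zero M W α n hn hm (by linarith)

/-- `polyCut → 1` on the tube: eventually `polyCut n z = 1` for `z` in the tube. [folklore] -/
theorem polyCut_eventually_eq_one {z : E8} (hz : ∀ m ∈ M, ⟪z, W m⟫ < α m) :
    ∀ᶠ n : ℕ in atTop, polyCut M W α n z = 1 := by
  have h : ∀ m ∈ M, ∀ᶠ n : ℕ in atTop, 2 / (n : ℝ) ≤ α m - ⟪z, W m⟫ := fun m hm => by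
    have hgap : 0 < α m - ⟪z, W m⟫ := sub_pos.2 (hz m hm)
    have hlim : Tendsto (fun n : ℕ => 2 / (n : ℝ)) atTop (𝓝 0) := tendsto_const_div_atTop_nhds_zero_nat 2
    exact (hlim.eventually (Iic_mem_nhds hgap)).mono fun n hn => hn
  filter_upwards [(Finset.eventually_all M).2 h, eventually_ge_atTop 1] with n hn hn1
  exact polyCut_eq_one M W α n hn1 hn

/-- **Support**: `tsupport (polyCut n) ⊆ {z : ∀ m ∈ M, ⟪z, Wₘ⟫ < αₘ}` (`n ≥ 1`): the support lies in the closed set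
where all gaps are `≥ 1/n`. [folklore] -/
theorem tsupport_polyCut_subset (hn : 1 ≤ n) : tsupport (polyCut M W α n) ⊆ {z | ∀ m ∈ M, ⟪z, W m⟫ < α m} := by
  have hn' : (0 : ℝ) < n := by exact_mod_cast hn
  have hclosed : IsClosed {z : E8 | ∀ m ∈ M, 1 / (n : ℝ) ≤ α m - ⟪z, W m⟫} := by
    have : {z : E8 | ∀ m ∈ M, 1 / (n : ℝ) ≤ α m - ⟪z, W m⟫} = ⋂ m ∈ M, {z : E8 | 1 / (n : ℝ) ≤ α m - ⟪z, W m⟫} := by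
      ext z; simp
    rw [this]
    exact isClosed_biInter fun m _ => isClosed_le continuous_const (continuous_const.sub (continuous_id.inner continuous_const))
  have hsupp : support (polyCut M W α n) ⊆ {z : E8 | ∀ m ∈ M, 1 / (n : ℝ) ≤ α m - ⟪z, W m⟫} := by
    intro z hz m hm
    by_contra hlt
    exact hz (polyCut_eq_zero M W α n hn hm (le_of_lt (not_le.1 hlt)))
  intro z hz m hm
  have h := (closure_minimal hsupp hclosed) hz m hm
  have : (0 : ℝ) < 1 / n := by positivity
  linarith

/-- `polyCut` is `C¹`. [folklore] -/
theorem contDiff_polyCut : ContDiff ℝ 1 (polyCut M W α n) := by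
  unfold polyCut
  exact contDiff_prod fun m _ => contDiff_wallCut _ _ _

/-- **Derivative of the product cut-off**:
`D(polyCut)(z) v = Σₘ (Π_{m' ≠ m} wallCut_{m'}(z)) θ′ₘ(z) (-n) ⟪v, Wₘ⟫`. [folklore] -/
theorem fderiv_polyCut_apply [DecidableEq ι] (z v : E8) :
    fderiv ℝ (polyCut M W α n) z v = ∑ m ∈ M, (∏ m' ∈ M.erase m, wallCut (W m') (α m') n z) *
      (deriv Real.smoothTransition ((n : ℝ) * (α m - ⟪z, W m⟫) - 1) * (-(n : ℝ)) * ⟪v, W m⟫) := by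
  have h : HasFDerivAt (polyCut M W α n) (∑ m ∈ M, (∏ m' ∈ M.erase m, wallCut (W m') (α m') n z) •
      ((deriv Real.smoothTransition ((n : ℝ) * (α m - ⟪z, W m⟫) - 1) * (-(n : ℝ))) • (innerSL ℝ (W m) : E8 →L[ℝ] ℝ))) z := by
    unfold polyCut
    exact HasFDerivAt.finsetProd fun m _ => hasFDerivAt_wallCut (W m) (α m) n z
  rw [h.fderiv, _root_.FunLike.coe_sum, Finset.sum_apply]
  refine Finset.sum_congr rfl fun m _ => ?_
  simp only [_root_.FunLike.coe_smul, Pi.smul_apply, innerSL_apply_apply, smul_eq_mul, real_inner_comm (W m) v]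

end Poly

end Summit.AtomisticToContinuum.Crystallization.Theorems.PricedLinkCensusLocalToGlobal

end
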